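import Mathlib
import Literature.Probability.LatticeModels.ProdBernoulliIndependence
import Summits.CriticalPhenomena.PercolationContinuityZ3.Theorems.PercNearOneGluingNearOneGluingSprinkled
import HarnessLib

/-!
# Crux `PercNearOneGluing.NearOneGluing` (stmt-CriticalPhenomena-4574), line
# `live-seal-vanishing-sprinkle` — selected-relay forms of K1 / K1′

Helper file for the crux (lead prover-line-stmt-CriticalPhenomena-4574-a1-1): proves exactly the
three registered stubs `exposureDecompWeighted`, `liveSeal_exposureBound_selected` and
`sprinkledNearOneGluing_selected` of the line skeleton. Lands with
`--supports stmt-CriticalPhenomena-4574`.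

Setting: one finite weighted graph — vertices `Fin n`, weights `w`, `μ = prodBernoulli w` on bond
configurations `ω : Set (Sym2 (Fin n))`; relay set `A`, source `o ∉ A`, target `b`;
bad `= {o ↮ b} ∩ {o ↔ A}`; `P ω` the relay-free pocket of `o` (`v ∈ P ω ↔ o ↔ v inside (↑A)ᶜ`);
`L T ω` the live boundary pairs of `T` towards `b` (`s(x, y)`, `x ∈ T`, `y ∉ T`,
`y ↔ b inside (↑T)ᶜ`); `κ_T(ω) = ∏_{e ∈ L T ω} (1 - w e)`; the class map
`cls ω = (P ω, E*(ω))`, `E*(ω) = {a ∈ A | ∃ x ∈ P ω, s(x, a) ∈ ω}` (relays attached to the pocket).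

* `exposureDecompWeighted`: the exposure decomposition `stub_exposureDecomp` with a CLASS-DEPENDENT
  bound `c (T, E)` on the transfer integrals:
  `μ{bad ∧ θ ≤ κ_{P ω}} ≤ (Σ_p μ(cls = p) · c p) / θ`. Same proof (strong Markov factorisation at
  the pocket + Markov's inequality in `θ`), summed class by class.
* `liveSeal_exposureBound_selected` (selected-relay K1): with `c (T, E) = r (sel (T, E))` for a
  selector `sel (T, E) ∈ E` and relay reliabilities `μ(a ↮ b) ≤ r a`, via `stub_transferIneq`
  applied to the selected attached relay.
* `sprinkledNearOneGluing_selected` (selected-relay K1′): for `0 < t < 1` and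
  `1 - w' = (1 - w)^{1+t}`,
  `μ_{w'}(o ↮ b) ≤ μ_w(o ↮ A) + ρ^t/(1-t)`, `ρ = Σ_p μ_w(cls = p) · r (sel p)`:
  `stub_sprinkleCoupling` + `stub_layerCake` fed with the selected-relay K1 tail bounds.
  The buffered-bad cost is paid by the best relay actually attached to `o`'s pocket, averaged over
  the pocket class, instead of `max_{a ∈ A}`.
-/

namespace Summit.CriticalPhenomena.PercolationContinuityZ3.Theorems

open scoped BigOperators Classical
open MeasureTheory Set
open Literature.Probability.LatticeModels (prodBernoulli)
open Literature.Probability.Percolation (openConn openConnIn)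

/-- **Weighted exposure decomposition** (registered stub `exposureDecompWeighted` of crux
stmt-CriticalPhenomena-4574, line `live-seal-vanishing-sprinkle`). With the relay-free pocket
`P ω`, the live pairs `L T ω` and the class map `cls ω = (P ω, {a ∈ A | ∃ x ∈ P ω, s(x, a) ∈ ω})`:
if every transfer integral `∫ 1{∀ e ∈ E, e ↮ b inside (↑T)ᶜ} · ∏_{e ∈ L T ω} (1 - w e) dμ` over
admissible `(T, E, a)` (`o ∈ T`, `b ∉ T`, `T ∩ A = ∅`, `a ∈ E ⊆ A`) is `≤ c (T, E)` (`c ≥ 0`), then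
`μ{o ↮ b ∧ o ↔ A ∧ θ ≤ ∏_{e ∈ L (P ω) ω} (1 - w e)} ≤ (Σ_p μ(cls = p) · c p) / θ`.
Proof: the proof of `stub_exposureDecomp` class by class — a nonempty class `{cls = (T, E)}` is
admissible (`exposureDecomp_exists_attached`) and its bad-and-buffered part lies in
`{cls = (T, E)} ∩ {cut_E} ∩ {θ ≤ κ_T}`; the class is determined by the pairs incident to `T`, the
other two events by the pairs inside `(↑T)ᶜ`, so the measure factorises
(`prodBernoulli_real_inter_of_determinedBy`); Markov's inequality and `hT` bound the second factor
by `c (T, E) / θ`; sum over the classes. -/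
theorem exposureDecompWeighted (n : ℕ) (w : Sym2 (Fin n) → unitInterval) (A : Finset (Fin n))
    (o b : Fin n) (ho : o ∉ A) (θ : ℝ) (hθ : 0 < θ)
    (c : Finset (Fin n) × Finset (Fin n) → ℝ) (hc : ∀ p, 0 ≤ c p)
    (P : Set (Sym2 (Fin n)) → Finset (Fin n))
    (hP : ∀ ω v, v ∈ P ω ↔ ω ∈ openConnIn ((↑A : Set (Fin n))ᶜ) o v)
    (L : Finset (Fin n) → Set (Sym2 (Fin n)) → Finset (Sym2 (Fin n)))
    (hL : ∀ T ω e, e ∈ L T ω ↔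
      ∃ x ∈ T, ∃ y ∉ T, e = s(x, y) ∧ ω ∈ openConnIn ((↑T : Set (Fin n))ᶜ) y b)
    (hT : ∀ (T E : Finset (Fin n)) (a : Fin n), a ∈ E → E ⊆ A → o ∈ T → b ∉ T → Disjoint T A →
      ∫ ω, ({ω | ∀ e ∈ E, ω ∉ openConnIn ((↑T : Set (Fin n))ᶜ) e b}.indicator
          (fun ω => ∏ e ∈ L T ω, (1 - (w e : ℝ))) ω) ∂(prodBernoulli w) ≤ c (T, E)) :
    (prodBernoulli w).real {ω | ω ∉ openConn o b ∧ (∃ a ∈ A, ω ∈ openConn o a) ∧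
        θ ≤ ∏ e ∈ L (P ω) ω, (1 - (w e : ℝ))} ≤
      (∑ p : Finset (Fin n) × Finset (Fin n), (prodBernoulli w).real
        ((fun ω => (P ω, A.filter fun a => ∃ x ∈ P ω, s(x, a) ∈ ω)) ⁻¹' {p}) * c p) / θ := by
  set μ := prodBernoulli w with hμ
  -- the attached relays `E*(ω)` and the class map `ω ↦ (P ω, E*(ω))`
  set cls : Set (Sym2 (Fin n)) → Finset (Fin n) × Finset (Fin n) :=
    fun ω => (P ω, A.filter fun a => ∃ x ∈ P ω, s(x, a) ∈ ω) with hcls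
  set S : Set (Set (Sym2 (Fin n))) := {ω | ω ∉ openConn o b ∧ (∃ a ∈ A, ω ∈ openConn o a) ∧
    θ ≤ ∏ e ∈ L (P ω) ω, (1 - (w e : ℝ))} with hS
  have hcθ : ∀ p, 0 ≤ c p / θ := fun p => div_nonneg (hc p) hθ.le
  -- the per-class bound
  have hclass : ∀ p : Finset (Fin n) × Finset (Fin n),
      μ.real (S ∩ cls ⁻¹' {p}) ≤ μ.real (cls ⁻¹' {p}) * (c p / θ) := by
    rintro ⟨T, E⟩
    by_cases hem : S ∩ cls ⁻¹' {(T, E)} = ∅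
    · rw [hem, measureReal_empty]
      exact mul_nonneg measureReal_nonneg (hcθ _)
    obtain ⟨ω₀, hω₀S, hω₀c⟩ := Set.nonempty_iff_ne_empty.2 hem
    rw [mem_preimage, mem_singleton_iff, hcls, Prod.mk.injEq] at hω₀c
    obtain ⟨hPT, hET⟩ := hω₀c
    obtain ⟨hω₀b, ⟨a₀, ha₀A, hω₀a⟩, -⟩ := hω₀S
    -- admissibility of the class, read off `ω₀`
    have hoT : o ∈ T := hPT ▸ exposureDecomp_self_mem_pocket hP ho ω₀
    have hTA : Disjoint T A := hPT ▸ exposureDecomp_pocket_disjoint hP ω₀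
    have hbT : b ∉ T := hPT ▸ exposureDecomp_notMem_pocket_of_notMem_openConn hP hω₀b
    have hEA : E ⊆ A := hET ▸ Finset.filter_subset _ _
    obtain ⟨a, haE⟩ : E.Nonempty := by
      obtain ⟨y, hyA, x, hxP, hxy⟩ := exposureDecomp_exists_attached hP ho ha₀A hω₀a
      exact ⟨y, hET ▸ Finset.mem_filter.2 ⟨hyA, x, hxP, hxy⟩⟩
    -- the pairs incident to `T` and the three events
    set F : Finset (Sym2 (Fin n)) := Finset.univ.filter fun e : Sym2 (Fin n) =>
      ∃ x ∈ T, ∃ y, e = s(x, y) with hF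
    have hFT : ∀ x y, x ∈ T → s(x, y) ∈ F := fun x y hx => exposureDecomp_mem_incident x y hx
    have hK : ((↑T : Set (Fin n))ᶜ).sym2 ⊆ (↑F : Set (Sym2 (Fin n)))ᶜ :=
      exposureDecomp_sym2_compl_subset T
    set D : Set (Set (Sym2 (Fin n))) :=
      {ω | ∀ e ∈ E, ω ∉ openConnIn ((↑T : Set (Fin n))ᶜ) e b} with hD
    set B : Set (Set (Sym2 (Fin n))) := {ω | θ ≤ ∏ e ∈ L T ω, (1 - (w e : ℝ))} with hB
    have hsub : S ∩ cls ⁻¹' {(T, E)} ⊆ cls ⁻¹' {(T, E)} ∩ (D ∩ B) := by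
      rintro ω ⟨⟨hωb, -, hωθ⟩, hωc⟩
      have hωc' := hωc
      rw [mem_preimage, mem_singleton_iff, hcls, Prod.mk.injEq] at hωc'
      obtain ⟨hPω, hEω⟩ := hωc'
      refine ⟨hωc, fun e he heb => hωb ?_, ?_⟩
      · rw [← hEω, Finset.mem_filter] at he
        obtain ⟨heA, x, hx, hxe⟩ := he
        exact exposureDecomp_mem_openConn_of_attached hP hx hxe heA heb
      · show θ ≤ ∏ e ∈ L T ω, (1 - (w e : ℝ))
        rw [← hPω]; exact hωθ
    have hdetC : Literature.Probability.Percolation.DeterminedBy (cls ⁻¹' {(T, E)})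
        (↑F : Set (Sym2 (Fin n))) := by
      have hpre : cls ⁻¹' {(T, E)} =
          {ω | P ω = T ∧ (A.filter fun a => ∃ x ∈ P ω, s(x, a) ∈ ω) = E} := by
        ext ω
        simp only [mem_preimage, mem_singleton_iff, hcls, Prod.mk.injEq, mem_setOf_eq]
      rw [hpre]
      exact exposureDecomp_determinedBy_class hP ho T E hFT
    have hdetDB : Literature.Probability.Percolation.DeterminedBy (D ∩ B)
        (↑F : Set (Sym2 (Fin n)))ᶜ :=
      (exposureDecomp_determinedBy_cut T E b hK).inter
        (exposureDecomp_determinedBy_live hL T (fun M => θ ≤ ∏ e ∈ M, (1 - (w e : ℝ))) hK)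
    have hind : μ.real (cls ⁻¹' {(T, E)} ∩ (D ∩ B)) =
        μ.real (cls ⁻¹' {(T, E)}) * μ.real (D ∩ B) :=
      Literature.Probability.LatticeModels.prodBernoulli_real_inter_of_determinedBy w F hdetC
        hdetDB MeasurableSet.of_discrete MeasurableSet.of_discrete
    -- Markov and the (class-dependent) transfer hypothesis
    have hmarkov : μ.real (D ∩ B) ≤ c (T, E) / θ := by
      rw [le_div_iff₀ hθ, mul_comm]
      exact (exposureDecomp_markov w D (fun ω => ∏ e ∈ L T ω, (1 - (w e : ℝ)))
        (fun ω => Finset.prod_nonneg fun e _ => sub_nonneg.2 (w e).2.2) θ).trans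
        (hT T E a haE hEA hoT hbT hTA)
    calc μ.real (S ∩ cls ⁻¹' {(T, E)})
        ≤ μ.real (cls ⁻¹' {(T, E)} ∩ (D ∩ B)) := measureReal_mono hsub
      _ = μ.real (cls ⁻¹' {(T, E)}) * μ.real (D ∩ B) := hind
      _ ≤ μ.real (cls ⁻¹' {(T, E)}) * (c (T, E) / θ) :=
          mul_le_mul_of_nonneg_left hmarkov measureReal_nonneg
  -- assembly: partition by the class and sum the per-class bounds
  have hcover : S ⊆ ⋃ p ∈ (Finset.univ : Finset (Finset (Fin n) × Finset (Fin n))),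
      (S ∩ cls ⁻¹' {p}) := by
    intro ω hω
    simp only [mem_iUnion, exists_prop]
    exact ⟨cls ω, Finset.mem_univ _, hω, rfl⟩
  calc μ.real S
      ≤ μ.real (⋃ p ∈ (Finset.univ : Finset (Finset (Fin n) × Finset (Fin n))),
          (S ∩ cls ⁻¹' {p})) := measureReal_mono hcover (measure_ne_top _ _)
    _ ≤ ∑ p ∈ (Finset.univ : Finset (Finset (Fin n) × Finset (Fin n))),
          μ.real (S ∩ cls ⁻¹' {p}) := measureReal_biUnion_finset_le _ _
    _ ≤ ∑ p ∈ (Finset.univ : Finset (Finset (Fin n) × Finset (Fin n))),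
          μ.real (cls ⁻¹' {p}) * (c p / θ) := Finset.sum_le_sum fun p _ => hclass p
    _ = (∑ p ∈ (Finset.univ : Finset (Finset (Fin n) × Finset (Fin n))),
          μ.real (cls ⁻¹' {p}) * c p) / θ := by
        rw [Finset.sum_div]
        exact Finset.sum_congr rfl fun p _ => (mul_div_assoc _ _ _).symm

/-- **Selected-relay K1 (exposure bound)** (registered stub `liveSeal_exposureBound_selected` of
crux stmt-CriticalPhenomena-4574, line `live-seal-vanishing-sprinkle`). If `o ∉ A`,
`μ(a ↮ b) ≤ r a` (`r ≥ 0`) for every relay `a ∈ A`, and `sel (T, E) ∈ E` whenever `E ≠ ∅`, then for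
every `θ > 0` and all pocket / live selectors `P`, `L`:
`μ{o ↮ b ∧ o ↔ A ∧ θ ≤ κ_{P ω}} ≤ (Σ_{(T,E)} μ(cls = (T, E)) · [E ≠ ∅] r (sel (T, E))) / θ`.
Proof: `exposureDecompWeighted` with `c (T, E) = [E ≠ ∅] r (sel (T, E))`; an admissible class has
`E ∋ a`, so `sel (T, E) ∈ E ⊆ A` and `stub_transferIneq` for the selected relay bounds the transfer
integral by `μ(sel (T, E) ↮ b) ≤ r (sel (T, E))`. -/
theorem liveSeal_exposureBound_selected : ∀ (n : ℕ) (w : Sym2 (Fin n) → unitInterval) (A : Finset (Fin n)) (o b : Fin n), o ∉ A → ∀ (r : Fin n → ℝ), (∀ a, 0 ≤ r a) → (∀ a ∈ A, (Literature.Probability.LatticeModels.prodBernoulli w).real (Literature.Probability.Percolation.openConn a b)ᶜ ≤ r a) → ∀ (sel : Finset (Fin n) × Finset (Fin n) → Fin n), (∀ p, p.2.Nonempty → sel p ∈ p.2) → ∀ θ : ℝ, 0 < θ → ∀ (P : Set (Sym2 (Fin n)) → Finset (Fin n)), (∀ ω v, v ∈ P ω ↔ ω ∈ Literature.Probability.Percolation.openConnIn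 ((↑A : Set (Fin n))ᶜ) o v) → ∀ (L : Finset (Fin n) → Set (Sym2 (Fin n)) → Finset (Sym2 (Fin n))), (∀ T ω e, e ∈ L T ω ↔ ∃ x ∈ T, ∃ y ∉ T, e = s(x, y) ∧ ω ∈ Literature.Probability.Percolation.openConnIn ((↑T : Set (Fin n))ᶜ) y b) → (Literature.Probability.LatticeModels.prodBernoulli w).real {ω | ω ∉ Literature.Probability.Percolation.openConn o b ∧ (∃ a ∈ A, ω ∈ Literature.Probability.Percolation.openConn o a) ∧ θ ≤ ∏ e ∈ L (P ω) ω, (1 - (w e : ℝ))} ≤ (∑ p : Finset (Fin n) × Finset (Fin n), (Literature.Probability.LatticeModels.prodBernoulli w).real ((fun ω => (P ω, A.filter fun a => ∃ x ∈ P ω, s(x, a) ∈ ω)) ⁻¹' {p}) * (if p.2.Nonempty then r (sel p) else 0)) / θ := by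
  intro n w A o b ho r hr hrel sel hsel θ hθ P hP L hL
  refine exposureDecompWeighted n w A o b ho θ hθ
    (fun p => if p.2.Nonempty then r (sel p) else 0) (fun p => ?_) P hP L hL ?_
  · show 0 ≤ (if p.2.Nonempty then r (sel p) else 0)
    split_ifs
    · exact hr _
    · exact le_rfl
  · intro T E a ha hEA _hoT hbT _hTA
    have hE : E.Nonempty := ⟨a, ha⟩
    have hsE : sel (T, E) ∈ E := hsel (T, E) hE
    show _ ≤ (if E.Nonempty then r (sel (T, E)) else 0)
    rw [if_pos hE]
    exact (stub_transferIneq n w T E (sel (T, E)) b hsE hbT (L T) (hL T)).trans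
      (hrel _ (hEA hsE))

/-- **Selected-relay K1′ (sprinkled near-one gluing)** (registered stub
`sprinkledNearOneGluing_selected` of crux stmt-CriticalPhenomena-4574, line
`live-seal-vanishing-sprinkle`). For `0 < t < 1` and weights with `1 - w' = (1 - w)^{1+t}`: if
`o ∉ A`, `μ_w(a ↮ b) ≤ r a` (`r ≥ 0`) on `A` and `sel (T, E) ∈ E` whenever `E ≠ ∅`, then for every
pocket selector `P`, `μ_{w'}(o ↮ b) ≤ μ_w(o ↮ A) + ρ^t/(1-t)` with
`ρ = Σ_{(T,E)} μ_w(cls = (T, E)) · [E ≠ ∅] r (sel (T, E))`.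
Proof: the proof of `sprinkledNearOneGluing` with `s` replaced by `ρ` — `stub_sprinkleCoupling`
(union with an independent `t`-layer) bounds the left side by `μ_w(o ↮ A) + ∫_bad κ^t`, and
`stub_layerCake` turns the selected-relay K1 tail bounds `liveSeal_exposureBound_selected` into
`∫_bad κ^t ≤ ρ^t/(1-t)`. -/
theorem sprinkledNearOneGluing_selected : ∀ (t : ℝ), 0 < t → t < 1 → ∀ (n : ℕ) (w w' : Sym2 (Fin n) → unitInterval), (∀ e, (1 - (w' e : ℝ)) = (1 - (w e : ℝ)) ^ (1 + t)) → ∀ (A : Finset (Fin n)) (o b : Fin n), o ∉ A → ∀ (r : Fin n → ℝ), (∀ a, 0 ≤ r a) → (∀ a ∈ A, (Literature.Probability.LatticeModels.prodBernoulli w).real (Literature.Probability.Percolation.openConn a b)ᶜ ≤ r a) → ∀ (sel : Finset (Fin n) × Finset (Fin n) → Fin n), (∀ p, p.2.Nonempty → sel p ∈ p.2) → ∀ (P : Set (Sym2 (Fin n)) → Finset (Fin n)), (∀ ω v, v ∈ P ω ↔ ω ∈ Literature.Probability.Percolation.openConnIn ((↑A : Set (Fin n))ᶜ) o v) → (Literature.Probability.LatticeModels.prodBernoulli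 w').real (Literature.Probability.Percolation.openConn o b)ᶜ ≤ (Literature.Probability.LatticeModels.prodBernoulli w).real (⋃ a ∈ A, Literature.Probability.Percolation.openConn o a)ᶜ + (∑ p : Finset (Fin n) × Finset (Fin n), (Literature.Probability.LatticeModels.prodBernoulli w).real ((fun ω => (P ω, A.filter fun a => ∃ x ∈ P ω, s(x, a) ∈ ω)) ⁻¹' {p}) * (if p.2.Nonempty then r (sel p) else 0)) ^ t / (1 - t) := by
  intro t ht0 ht1 n w w' hw A o b ho r hr hrel sel hsel P hP
  -- concrete live selector
  set L : Finset (Fin n) → Set (Sym2 (Fin n)) → Finset (Sym2 (Fin n)) :=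
    fun T ω => Finset.univ.filter fun e : Sym2 (Fin n) =>
      ∃ x ∈ T, ∃ y ∉ T, e = s(x, y) ∧ ω ∈ openConnIn ((↑T : Set (Fin n))ᶜ) y b with hLdef
  have hL : ∀ T ω e, e ∈ L T ω ↔
      ∃ x ∈ T, ∃ y ∉ T, e = s(x, y) ∧ ω ∈ openConnIn ((↑T : Set (Fin n))ᶜ) y b := by
    intro T ω e; simp [hLdef]
  have hcpl := stub_sprinkleCoupling t ht0 n w w' hw A o b ho P hP L hL
  -- the averaged selected-relay cost `ρ`
  set ρ : ℝ := ∑ p : Finset (Fin n) × Finset (Fin n), (prodBernoulli w).real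
      ((fun ω => (P ω, A.filter fun a => ∃ x ∈ P ω, s(x, a) ∈ ω)) ⁻¹' {p}) *
        (if p.2.Nonempty then r (sel p) else 0) with hρdef
  have hρ0 : 0 ≤ ρ := by
    refine Finset.sum_nonneg fun p _ => mul_nonneg measureReal_nonneg ?_
    split_ifs
    · exact hr _
    · exact le_rfl
  -- layer cake on X = κ, B = bad
  set B : Set (Set (Sym2 (Fin n))) := {ω | ω ∉ openConn o b ∧ ∃ a ∈ A, ω ∈ openConn o a} with hBdef
  set X : Set (Sym2 (Fin n)) → ℝ := fun ω => ∏ e ∈ L (P ω) ω, (1 - (w e : ℝ)) with hXdef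
  have hX0 : ∀ ω, 0 ≤ X ω := fun ω =>
    Finset.prod_nonneg fun e _ => sub_nonneg.2 (w e).2.2
  have hX1 : ∀ ω, X ω ≤ 1 := fun ω =>
    Finset.prod_le_one (fun e _ => sub_nonneg.2 (w e).2.2) fun e _ => sub_le_self _ (w e).2.1
  have htail : ∀ θ : ℝ, 0 < θ →
      (prodBernoulli w).real (B ∩ {ω | θ ≤ X ω}) ≤ ρ / θ := by
    intro θ hθ
    have h := liveSeal_exposureBound_selected n w A o b ho r hr hrel sel hsel θ hθ P hP L hL
    have hset : B ∩ {ω | θ ≤ X ω} =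
        {ω | ω ∉ openConn o b ∧ (∃ a ∈ A, ω ∈ openConn o a) ∧
          θ ≤ ∏ e ∈ L (P ω) ω, (1 - (w e : ℝ))} := by
      ext ω; simp only [hBdef, hXdef, mem_inter_iff, mem_setOf_eq, and_assoc]
    rw [hset]; exact h
  have hlc := stub_layerCake (prodBernoulli w) B MeasurableSet.of_discrete X
    (Measurable.of_discrete) hX0 hX1 ρ t hρ0 ht0 ht1 htail
  have hint : ∫ ω, (B.indicator (fun ω => (∏ e ∈ L (P ω) ω, (1 - (w e : ℝ))) ^ t) ω)
      ∂(prodBernoulli w) ≤ ρ ^ t / (1 - t) := by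
    simpa [hXdef] using hlc
  calc (prodBernoulli w').real (openConn o b)ᶜ
      ≤ (prodBernoulli w).real (⋃ a ∈ A, openConn o a)ᶜ +
          ∫ ω, (B.indicator (fun ω => (∏ e ∈ L (P ω) ω, (1 - (w e : ℝ))) ^ t) ω)
            ∂(prodBernoulli w) := by simpa [hBdef] using hcpl
    _ ≤ (prodBernoulli w).real (⋃ a ∈ A, openConn o a)ᶜ + ρ ^ t / (1 - t) := by gcongr

end Summit.CriticalPhenomena.PercolationContinuityZ3.Theorems
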